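import Literature.AlgebraicGeometry.Resolution.DecompositionLayerAssembly
import HarnessLib

/-!
# [CoP1] Prop. 9.3, decomposition layer: (47) from Prop. 8.1 (1) — the non-exceptional parameters are strict transforms

Topic: `Literature/AlgebraicGeometry/Resolution`. PROOF side of `CossartPiltant2019ReductionP`
(`ArithmeticalThreefoldsLocal.lean`), input (C4), hypothesis `hDec` of
`cossartPiltant2019ReductionP_of_cjs_of_stableInertiaHensel` ([CoP1] Prop. 9.3, decomposition
layer). In `exists_localUniformization_of_head` (`DecompositionLayerAssembly.lean`) the head
contains clause (c): for `r ≤ j < 3` some `gⱼ ∈ R₁′` equals `uⱼ xⱼ ∏_{i<r} xᵢ^{cⱼᵢ}` in `S′`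
(the printed (47): "`P′ = (g′_{r+1}, …, g′₃)`", HAL p. 28, whose printed justification "in
algebraic terms" is terse). This file DERIVES (c) from property (1) of [CoP1] Prop. 8.1 read
for the underlying models — `S′ = (R₁′[t′])_𝔪` with `t′ ⊆ R₁′[1/f]` ("`(S₀)_f = S_f`") for an
`f ∈ R₁′` which is a unit times a monomial in `x₀, …, x_{r-1}` in `S′` (property (2):
"`√(fS) = (x₁ ⋯ x_r)`") — by a three-line argument: every `z ∈ S′` is `y/s` with `y ∈ S[t′]`,
`v(s) = 0`; `fⁿ y ∈ R₁′` for `n ≫ 0`; hence `G := fⁿ y = (wⁿ s) · z · ∏ xᵢ^{n eᵢ} ∈ R₁′`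
(`exists_mem_eq_unit_mul_prod_pow`). Consequently the head of the decomposition layer may be
taken to be [CoP1] Prop. 8.1 (1)–(2) (model reading) plus the choice (46) of the `fᵢ`
(`exists_localUniformization_of_head'`).

Everything is PROVED; no named facts, definitions, instances or notation are introduced.

## Sources

* V. Cossart, O. Piltant, J. Algebra 320 (2008) 1051–1082: Prop. 8.1 and proof of Prop. 9.3,
  (47)–(48) (HAL hal-00139124, pp. 22, 28). [CossartPiltant2008]
-/

noncomputable section

open IsLocalRing Polynomial IntermediateField

namespace Literature.AlgebraicGeometry.Resolution

universe u

section StrictParameters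

variable {S : Type u} [CommRing S] {E : Type u} [Field E] [Algebra S E]

/-- If `S ⊆ R`, `f ∈ R` and every `z ∈ t′` has `fⁿ z ∈ R` for some `n`, then every element of
`S[t′]` has `fⁿ y ∈ R` for some `n` ("`(S₀)_f = S_f`" for the models, [CoP1] Prop. 8.1 (1)).
[cite: CossartPiltant2008, Prop. 8.1 (1) (HAL p. 22)] -/
theorem exists_pow_mul_mem_of_mem_adjoin (R : Subring E) (hSR : ∀ s : S, algebraMap S E s ∈ R)
    {f : E} (hf : f ∈ R) (t' : Set E) (ht' : ∀ z ∈ t', ∃ n : ℕ, f ^ n * z ∈ R)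
    {y : E} (hy : y ∈ Algebra.adjoin S t') : ∃ n : ℕ, f ^ n * y ∈ R := by
  let C : Subalgebra S E :=
    { carrier := {y | ∃ n : ℕ, f ^ n * y ∈ R}
      mul_mem' := by
        rintro a b ⟨m, hm⟩ ⟨n, hn⟩
        refine ⟨m + n, ?_⟩
        rw [pow_add, mul_mul_mul_comm]
        exact R.mul_mem hm hn
      one_mem' := ⟨0, by rw [pow_zero, one_mul]; exact R.one_mem⟩
      add_mem' := by
        rintro a b ⟨m, hm⟩ ⟨n, hn⟩
        refine ⟨m + n, ?_⟩
        rw [mul_add]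
        refine R.add_mem ?_ ?_
        · rw [pow_add, mul_comm (f ^ m), mul_assoc]
          exact R.mul_mem (R.pow_mem hf n) hm
        · rw [pow_add, mul_assoc]
          exact R.mul_mem (R.pow_mem hf m) hn
      zero_mem' := ⟨0, by rw [mul_zero]; exact R.zero_mem⟩
      algebraMap_mem' := fun s => ⟨0, by rw [pow_zero, one_mul]; exact hSR s⟩ }
  have hle : Algebra.adjoin S t' ≤ C := Algebra.adjoin_le ht'
  exact hle hy

/-- **(47) from Prop. 8.1 (1): every element of `S′` is, up to a unit and a monomial in the
exceptional parameters, an element of `R₁′`.** Let `S′ = (S[t′])_𝔪 ⊇ R ⊇ S` with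
`t′ ⊆ R[1/f]` for some `f ∈ R` which in `S′` is a unit times a monomial in `x₀, …, x_{r-1}`.
Then for every `z ∈ S′` there are `G ∈ R`, a unit `u` of `S′` and exponents `cᵢ` with
`G = u · z · ∏_{i<r} xᵢ^{cᵢ}` (for `z = xⱼ`, `j ≥ r`: "the strict transform of `G` is `xⱼ`").
[cite: CossartPiltant2008, Prop. 8.1 (1)–(2) and proof of Prop. 9.3, (47)–(48) (HAL pp. 22, 28)] -/
theorem exists_mem_eq_unit_mul_prod_pow (O : ValuationSubring E) (t' : Finset E)
    (hTO' : (Algebra.adjoin S (t' : Set E)).toSubring ≤ O.toSubring)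
    (R : Subring E) (hSR : ∀ s : S, algebraMap S E s ∈ R)
    {r : ℕ} (xr : Fin r → locAtCentre (Algebra.adjoin S (t' : Set E)).toSubring O)
    (f : E) (hfR : f ∈ R) (w : (locAtCentre (Algebra.adjoin S (t' : Set E)).toSubring O)ˣ)
    (e : Fin r → ℕ)
    (hf : f = ((w : locAtCentre (Algebra.adjoin S (t' : Set E)).toSubring O) : E) *
      ∏ i, ((xr i : locAtCentre (Algebra.adjoin S (t' : Set E)).toSubring O) : E) ^ e i)
    (ht' : ∀ z ∈ (t' : Set E), ∃ n : ℕ, f ^ n * z ∈ R)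
    (z : locAtCentre (Algebra.adjoin S (t' : Set E)).toSubring O) :
    ∃ (G : E) (u : (locAtCentre (Algebra.adjoin S (t' : Set E)).toSubring O)ˣ) (c : Fin r → ℕ),
      G ∈ R ∧ G = ((u : locAtCentre (Algebra.adjoin S (t' : Set E)).toSubring O) : E) * (z : E) *
        ∏ i, ((xr i : locAtCentre (Algebra.adjoin S (t' : Set E)).toSubring O) : E) ^ c i := by
  haveI : IsLocalRing (locAtCentre (Algebra.adjoin S (t' : Set E)).toSubring O) :=
    isLocalRing_locAtCentre hTO'
  obtain ⟨y, hy, s, hs, hvs, hz⟩ := z.2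
  obtain ⟨n, hn⟩ := exists_pow_mul_mem_of_mem_adjoin R hSR hfR _ ht' hy
  -- `s` is a unit of `S′`
  let sS : locAtCentre (Algebra.adjoin S (t' : Set E)).toSubring O := ⟨s, le_locAtCentre _ _ hs⟩
  have hsU : IsUnit sS := by
    by_contra hnu
    have hlt := (not_isUnit_locAtCentre_iff hTO' sS).mp hnu
    change O.valuation s < 1 at hlt
    rw [hvs] at hlt
    exact lt_irrefl _ hlt
  obtain ⟨sU, hsU'⟩ := hsU
  refine ⟨f ^ n * y, w ^ n * sU, fun i => n * e i, hn, ?_⟩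
  have hs0 : s ≠ 0 := ne_zero_of_valuation_eq_one hvs
  have hyz : y = (z : E) * s := by
    rw [hz, div_mul_cancel₀ _ hs0]
  have hsE : (((sU : (locAtCentre (Algebra.adjoin S (t' : Set E)).toSubring O)ˣ) :
      locAtCentre (Algebra.adjoin S (t' : Set E)).toSubring O) : E) = s := by rw [hsU']
  rw [hyz, hf, Units.val_mul, Units.val_pow_eq_pow_val, Subring.coe_mul, Subring.coe_pow, hsE,
    mul_pow, ← Finset.prod_pow]
  simp_rw [← pow_mul, mul_comm (e _) n]
  ring

end StrictParameters

section Head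

variable {S : Type u} [CommRing S] [IsDomain S] [IsRegularLocalRing S] {E : Type u} [Field E]
  [Algebra S E]

set_option maxHeartbeats 800000 in
/-- **[CoP1] Prop. 9.3, decomposition layer, from Prop. 8.1 (1)–(2) (model reading) and (46).**
`exists_localUniformization_of_head` with clause (c) of the head replaced by property (1) of
[CoP1] Prop. 8.1 for the models: some `f ∈ R₁′`, a unit times a monomial in `x₀, …, x_{r-1}`
in `S′`, with `t′ ⊆ R₁′[1/f]`; clause (c) follows by `exists_mem_eq_unit_mul_prod_pow`.
[cite: CossartPiltant2008, Prop. 8.1 and proof of Prop. 9.3 (HAL pp. 22, 27–28)] -/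
theorem exists_localUniformization_of_head' [Algebra.IsAlgebraic S E]
    (hS : IsExcellentRing S) (hinj : Function.Injective (algebraMap S E))
    (hScomp : IsAdicComplete (maximalIdeal S) S)
    (OE : ValuationSubring E) (hSO : ∀ s : S, algebraMap S E s ∈ OE)
    (hdom : ∀ s ∈ maximalIdeal S, OE.valuation (algebraMap S E s) < 1)
    (hres : ∀ y : OE, ∃ q : S[X], (∃ i, q.coeff i ∉ maximalIdeal S) ∧
      OE.valuation (q.eval₂ (algebraMap S E) y) < 1)
    (M : Subfield E) (hSM : ∀ s : S, algebraMap S E s ∈ M)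
    (N : IntermediateField M E) [FiniteDimensional M N] [IsGalois M N] (K' : Subfield E)
    (hMK' : M ≤ K') (hK'Z : K' ≤ (lift (fixedField (decompositionGroupIn OE N))).toSubfield)
    (hLUK' : ∃ t : Finset E, (t : Set E) ⊆ K' ∧
      K' ≤ Subfield.closure (Set.range (algebraMap S E) ∪ (t : Set E)) ∧
      ∃ hTO : (Algebra.adjoin S (t : Set E)).toSubring ≤ OE.toSubring,
        IsRegularLocalRing (Localization.AtPrime
          (Ideal.comap (Subring.inclusion hTO) (maximalIdeal OE))))
    (hHead : ∀ (t₁ : Finset E), (t₁ : Set E) ⊆ M →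
        M ≤ Subfield.closure (Set.range (algebraMap S E) ∪ (t₁ : Set E)) →
        (Algebra.adjoin S (t₁ : Set E)).toSubring ≤ OE.toSubring →
        (∀ x : E, x ∈ M → IsIntegral (Algebra.adjoin S (t₁ : Set E)) x →
          x ∈ Algebra.adjoin S (t₁ : Set E)) →
      ∀ (t₁' : Finset E), (t₁' : Set E) ⊆ K' →
        (∀ x : E, x ∈ K' → (IsIntegral (Algebra.adjoin S (t₁ : Set E)) x ↔
          x ∈ Algebra.adjoin S ((t₁ : Set E) ∪ (t₁' : Set E)))) →
      ∃ (t' : Finset E) (_ : (t' : Set E) ⊆ K')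
        (hTO' : (Algebra.adjoin S (t' : Set E)).toSubring ≤ OE.toSubring)
        (_ : Algebra.adjoin S ((t₁ : Set E) ∪ (t₁' : Set E)) ≤ Algebra.adjoin S (t' : Set E))
        (_ : IsRegularLocalRing (locAtCentre (Algebra.adjoin S (t' : Set E)).toSubring OE))
        (r : ℕ) (hr : r ≤ 3) (_ : 0 < r)
        (x : Fin 3 → locAtCentre (Algebra.adjoin S (t' : Set E)).toSubring OE),
        (∀ j, ((x j : locAtCentre (Algebra.adjoin S (t' : Set E)).toSubring OE) : E) ≠ 0) ∧
        (haveI := isLocalRing_locAtCentre hTO'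
         Ideal.span (Set.range x) =
           maximalIdeal (locAtCentre (Algebra.adjoin S (t' : Set E)).toSubring OE)) ∧
        (∀ y : locAtCentre (Algebra.adjoin S (t' : Set E)).toSubring OE,
          (y : E) ∈ locAtCentre (Algebra.adjoin S ((t₁ : Set E) ∪ (t₁' : Set E))).toSubring OE →
          OE.valuation (y : E) < 1 →
          y ∈ Ideal.span {∏ i : Fin r, x (Fin.castLE hr i)}) ∧
        (∃ (f : Fin r → E) (γ : Fin r → (locAtCentre (Algebra.adjoin S (t' : Set E)).toSubring OE)ˣ)
            (a : Matrix (Fin r) (Fin r) ℕ),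
          (∀ i, f i ∈ M) ∧
          (∀ i, f i = ((γ i : locAtCentre (Algebra.adjoin S (t' : Set E)).toSubring OE) : E) *
            ∏ j, ((x (Fin.castLE hr j) :
              locAtCentre (Algebra.adjoin S (t' : Set E)).toSubring OE) : E) ^ a i j) ∧
          (a.map (fun n : ℕ => (n : ℤ))).det ≠ 0) ∧
        (∃ (f₁ : E) (w : (locAtCentre (Algebra.adjoin S (t' : Set E)).toSubring OE)ˣ)
            (e : Fin r → ℕ),
          f₁ ∈ locAtCentre (Algebra.adjoin S ((t₁ : Set E) ∪ (t₁' : Set E))).toSubring OE ∧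
          f₁ = ((w : locAtCentre (Algebra.adjoin S (t' : Set E)).toSubring OE) : E) *
            ∏ i, ((x (Fin.castLE hr i) :
              locAtCentre (Algebra.adjoin S (t' : Set E)).toSubring OE) : E) ^ e i ∧
          ∀ z ∈ (t' : Set E), ∃ n : ℕ,
            f₁ ^ n * z ∈ locAtCentre (Algebra.adjoin S ((t₁ : Set E) ∪ (t₁' : Set E))).toSubring OE)) :
    ∃ t : Finset E, (t : Set E) ⊆ M ∧
      M ≤ Subfield.closure (Set.range (algebraMap S E) ∪ (t : Set E)) ∧
      ∃ hTO : (Algebra.adjoin S (t : Set E)).toSubring ≤ OE.toSubring,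
        IsRegularLocalRing (Localization.AtPrime
          (Ideal.comap (Subring.inclusion hTO) (maximalIdeal OE))) := by
  refine exists_localUniformization_of_head hS hinj hScomp OE hSO hdom hres M hSM N K' hMK' hK'Z
    hLUK' (fun t₁ ht₁M hMcl₁ ht₁O hnorm₁ t₁' ht₁'K' hext₁ => ?_)
  obtain ⟨t', ht'K', hTO', hle', hregS', r, hr, hr0, x, hx0, hxm, ha, hb, f₁, w, e, hf₁R, hf₁, ht'f⟩ :=
    hHead t₁ ht₁M hMcl₁ ht₁O hnorm₁ t₁' ht₁'K' hext₁
  refine ⟨t', ht'K', hTO', hle', hregS', r, hr, hr0, x, hx0, hxm, ha, hb, fun j _ => ?_⟩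
  have hSR : ∀ s : S, algebraMap S E s ∈
      locAtCentre (Algebra.adjoin S ((t₁ : Set E) ∪ (t₁' : Set E))).toSubring OE := fun s =>
    le_locAtCentre _ _ ((Algebra.adjoin S ((t₁ : Set E) ∪ (t₁' : Set E))).algebraMap_mem s)
  obtain ⟨G, u, c, hG, hGeq⟩ := exists_mem_eq_unit_mul_prod_pow OE t' hTO'
    (locAtCentre (Algebra.adjoin S ((t₁ : Set E) ∪ (t₁' : Set E))).toSubring OE) hSR
    (fun i => x (Fin.castLE hr i)) f₁ hf₁R w e hf₁ ht'f (x j)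
  exact ⟨G, u, c, hG, hGeq⟩

end Head

end Literature.AlgebraicGeometry.Resolution

end
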